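import Summits.BirchSwinnertonDyer.Rank1Residual.P2.CornerFTwoModelClasses
import Summits.BirchSwinnertonDyer.Rank1Residual.Additive.QuadraticTwistBSDComparisonIsogeny
import Literature.NumberTheory.EllipticCurves.IsogenyCompProofs
import Literature.NumberTheory.EllipticCurves.ComplexMultiplicationLFunctionIsogenyHoldsProofs
import HarnessLib

/-!
# Leaf CornerF @ `p = 2` — THE MODEL ATLAS, file 5 (cell `bsd-print-cf2`, D-0131 (2) print tier,
# typer ty2): the `2`-isogeny edge of the quartic family and the fold of the ramified class modulo
# the transport facts of `𝔅_ram`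

HONEST FRAMING (cell `bsd-print-cf2`, HOME `run/shared/lean/pub/bsd-print-cf2/`, verbatim in every
file): the partition leaf is `CornerF W 2` — `W/ℚ` globally minimal elliptic WITH CM and
`ord_{s=1} L(E,s) = 1`, at the prime `2` (rung leaf `WAllCornerFTwo`; OPEN AS A CLASS). Files 1–2
of the atlas write the ramified class `WAllCornerFTwoRamified` (consequent of crux 20362) as
(1) `BSD(E_n,2)` on the named models ∧ (2) the quartic twists `y² = x³ + Ax`, `−A ∉ ℤ²` ∧ (3) the
`j = 287496` twists ∧ (4) the `j = 8000` twists. Two ISOGENY edges connect these families to (1):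
every `j = 287496` curve is `2`-isogenous to an `E_n` (cell p4, `Theorems/PrintCf2RamifiedCongruentPartner`,
`ramified_j287496_iff_congruent` — not restated here), and — this file — `y² = x³ + Ax` is `2`-isogenous
to `y² = x³ − 4Ax` (Silverman III.4.5), so the quartic twists with `A = m² ∈ ℤ²` are isogenous to
`E_{2m}` (e.g. `y² = x³ + x ~ 64a1 = E₂`). Hence MODULO the three transport facts already in `𝔅_ram`
(Cassels `bsdRHS_eq_of_isIsogenous`, GZK `rank_eq_analyticRank_of_analyticRank_le_one`, analytic
continuation `hasEntireLFunction_rat` — displayed, never proved here) conjunct (2) shrinks to the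
quartic twists with `A ∉ ℤ²` AND `−A ∉ ℤ²`: the genuinely print-free part of `j = 1728`. This file
introduces NO definition and NO named fact (D-0026); §1 is fact-free, §2 displays the three facts.

## Contents

* §1 `Atlas.isIsogenous_quartic_neg_four_mul` (`y² = x³ + Ax ~ y² = x³ − 4Ax`),
  `Atlas.exists_isIsogenous_congruentNumberCurve_of_smul_quartic_sq` (a model of `y² = x³ + m²x` is
  isogenous to `E_n`, `n` square-free), `Atlas.quartic_trichotomy` (a model of `y² = x³ + Ax`, `A ∈ ℤ∖{0}`,
  is a model of some `E_n` ∨ isogenous to some `E_n` ∨ has `A, −A ∉ ℤ²`).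
* §2 `quarticConjunct_iff_of_transport` and `wAllCornerFTwoRamified_iff_models_of_transport`: granted
  `hCassels hGZK hmod`, `WAllCornerFTwoRamified ⟺ (1) ∧ (2″: A, −A ∉ ℤ²) ∧ (3) ∧ (4)`.

References: [SilvermanAEC2009] III.4 Example 4.5 (the `2`-isogeny of `y² = x³ + ax² + bx`), X.5 Prop.
5.4 (ii), X.6 Prop. 6.1; [Miller2011LMS] §1 ("BSD(E,p) is an isogeny invariant", Cassels) and Def. 1.1;
[Cassels1965ArithmeticVIII]; `Additive/QuadraticTwistBSDComparisonIsogeny.lean`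
(`TwistComparison.bsdp_of_bsdp_of_isIsogenous`); `P2/CornerFTwoModelClasses.lean`.
-/

noncomputable section

open scoped Classical

open WeierstrassCurve Literature.NumberTheory.EllipticCurves
  Literature.NumberTheory.EllipticCurves.Rank1Residual

set_option autoImplicit false

namespace Summit.BirchSwinnertonDyer.Rank1Residual.P2.CornerFTwo

/-! ## §1 The `2`-isogeny edge of the quartic family (fact-free) -/

namespace Atlas

variable {W : WeierstrassCurve ℚ}

/-- **`y² = x³ + Ax ~ y² = x³ − 4Ax`** (`A ≠ 0`): the explicit `2`-isogeny with kernel `{O, (0,0)}`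
(Silverman III.4.5 with `a = 0`, `b = A`; tree `twoIsogenyCodomain`). [cite: SilvermanAEC2009, III.4 Example 4.5] -/
theorem isIsogenous_quartic_neg_four_mul {A : ℚ} (hA : A ≠ 0) :
    IsIsogenous (⟨0, 0, 0, A, 0⟩ : WeierstrassCurve ℚ) ⟨0, 0, 0, -4 * A, 0⟩ := by
  haveI := isElliptic_quartic hA
  refine isIsogenous_of_eq_twoIsogenyCodomain _ ?_
  ext <;> simp [twoIsogenyCodomain]

/-- **A model of `y² = x³ + m²x` (`m ∈ ℤ∖{0}`) is `ℚ`-isogenous to a congruent-number curve `E_n`,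
`n` square-free** (`y² = x³ + m²x ~ y² = x³ − (2m)²x`, a model of `E_n` for `n` the square-free part of
`2m`, ty2 g0 `CongruentNumber.exists_smul_congruentNumberCurve_of_smul_eq_neg_sq`).
[cite: SilvermanAEC2009, III.4 Example 4.5 and X.6 Prop. 6.1] -/
theorem exists_isIsogenous_congruentNumberCurve_of_smul_quartic_sq {m : ℤ} (hm : m ≠ 0)
    [W.IsElliptic] {C : VariableChange ℚ}
    (hC : C • (⟨0, 0, 0, ((m : ℚ)) ^ 2, 0⟩ : WeierstrassCurve ℚ) = W) :
    ∃ n : ℕ, Squarefree n ∧ IsIsogenous W (congruentNumberCurve n) := by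
  have hmQ : (m : ℚ) ≠ 0 := by exact_mod_cast hm
  have hA : ((m : ℚ)) ^ 2 ≠ 0 := pow_ne_zero 2 hmQ
  have hA' : -4 * ((m : ℚ)) ^ 2 ≠ 0 := mul_ne_zero (by norm_num) hA
  haveI := isElliptic_quartic hA
  haveI := isElliptic_quartic hA'
  -- the edge, and the square-free normalisation of its codomain `y² = x³ − (2m)²x`
  have hedge := isIsogenous_quartic_neg_four_mul hA
  have h2m : (2 * (m : ℚ)) ≠ 0 := mul_ne_zero two_ne_zero hmQ
  have hV : (1 : VariableChange ℚ) • (⟨0, 0, 0, -4 * ((m : ℚ)) ^ 2, 0⟩ : WeierstrassCurve ℚ) =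
      ⟨0, 0, 0, -(2 * (m : ℚ)) ^ 2, 0⟩ := by
    rw [one_smul]; ext <;> simp; ring
  obtain ⟨n, hn, C', hC'⟩ :=
    CongruentNumber.exists_smul_congruentNumberCurve_of_smul_eq_neg_sq h2m hV
  haveI := isElliptic_congruentNumberCurve hn.ne_zero
  refine ⟨n, hn, ?_⟩
  -- `W ≅ (y² = x³ + m²x) ~ (y² = x³ − 4m²x) ≅ E_n`
  exact ((isIsogenous_of_smul_eq' hC).trans' hedge).trans' (isIsogenous_of_smul_eq' hC')

/-- **The quartic family, three ways.** A model `W` of `y² = x³ + Ax` (`A ∈ ℤ∖{0}`) is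
(a) a model of some `E_n`, `n` square-free (`−A ∈ ℤ²`), or (b) `ℚ`-isogenous to some `E_n`, `n`
square-free (`A ∈ ℤ²`; e.g. `y² = x³ + x ~ E₂`), or (c) has `A ∉ ℤ²` and `−A ∉ ℤ²` — the print-free
core of `j = 1728`. [cite: SilvermanAEC2009, III.4 Example 4.5, X.5 Prop. 5.4 (ii), X.6 Prop. 6.1] -/
theorem quartic_trichotomy {A : ℤ} (hA : A ≠ 0) [W.IsElliptic]
    (hW : ∃ C : VariableChange ℚ, C • (⟨0, 0, 0, (A : ℚ), 0⟩ : WeierstrassCurve ℚ) = W) :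
    (∃ n : ℕ, Squarefree n ∧ ∃ C : VariableChange ℚ, C • congruentNumberCurve n = W) ∨
    (∃ n : ℕ, Squarefree n ∧ IsIsogenous W (congruentNumberCurve n)) ∨
    (¬ IsSquare A ∧ ¬ IsSquare (-A)) := by
  rcases quartic_dichotomy hA hW with h | hneg
  · exact Or.inl h
  · by_cases hpos : IsSquare A
    · obtain ⟨m, hm⟩ := hpos
      have hm0 : m ≠ 0 := by rintro rfl; simp at hm; exact hA hm
      obtain ⟨C, hC⟩ := hW
      have hAm : ((A : ℚ)) = ((m : ℚ)) ^ 2 := by rw [hm]; push_cast; ring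
      rw [hAm] at hC
      exact Or.inr (Or.inl (exists_isIsogenous_congruentNumberCurve_of_smul_quartic_sq hm0 hC))
    · exact Or.inr (Or.inr ⟨hpos, hneg⟩)

end Atlas

open Atlas

/-! ## §2 The ramified class modulo the transport facts of `𝔅_ram` -/

/-- **Conjunct (2) folds onto conjunct (1) modulo Cassels + GZK + analytic continuation.** Granted
`bsdRHS_eq_of_isIsogenous`, `rank_eq_analyticRank_of_analyticRank_le_one`, `hasEntireLFunction_rat`
(three conjuncts of `𝔅_ram`, displayed) and conjunct (1) (`BSD(E_n,2)` for every square-free `n`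
with `r_an(E_n) = 1`), the quartic conjunct (2) of `wAllCornerFTwoRamified_iff_models` is equivalent to
its restriction to `A ∉ ℤ²`: the members with `A = m²` are `ℚ`-isogenous to an `E_n` of the same
analytic rank (`analyticRank_eq_of_isIsogenous'`), and `BSD(·,2)` moves along the isogeny
(`TwistComparison.bsdp_of_bsdp_of_isIsogenous`). [cite: Miller2011LMS, §1 and Def. 1.1]
[cite: SilvermanAEC2009, III.4 Example 4.5] -/
theorem quarticConjunct_iff_of_transport (hCassels : bsdRHS_eq_of_isIsogenous)
    (hGZK : rank_eq_analyticRank_of_analyticRank_le_one) (hmod : hasEntireLFunction_rat)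
    (h₁ : ∀ n : ℕ, Squarefree n → (congruentNumberCurve n).analyticRank = 1 →
      BSDp (congruentNumberCurve n) 2) :
    (∀ A : ℤ, A ≠ 0 → ¬ IsSquare (-A) →
        ∀ (W : WeierstrassCurve ℚ) [W.IsElliptic] [W.IsGloballyMinimal],
          (∃ C : VariableChange ℚ, C • (⟨0, 0, 0, (A : ℚ), 0⟩ : WeierstrassCurve ℚ) = W) →
          W.analyticRank = 1 → BSDp W 2) ↔
      (∀ A : ℤ, A ≠ 0 → ¬ IsSquare (-A) → ¬ IsSquare A →
        ∀ (W : WeierstrassCurve ℚ) [W.IsElliptic] [W.IsGloballyMinimal],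
          (∃ C : VariableChange ℚ, C • (⟨0, 0, 0, (A : ℚ), 0⟩ : WeierstrassCurve ℚ) = W) →
          W.analyticRank = 1 → BSDp W 2) := by
  refine ⟨fun h A hA hneg _ W _ _ hW hr => h A hA hneg W hW hr, fun h A hA hneg W _ _ hW hr => ?_⟩
  rcases quartic_trichotomy hA hW with ⟨n, hn, hWn⟩ | ⟨n, hn, hiso⟩ | ⟨hpos, -⟩
  · -- (a) cannot happen (`−A ∉ ℤ²`), but is harmless: transport by isomorphism
    have hr' : (congruentNumberCurve n).analyticRank = 1 := by
      rw [← CongruentNumber.analyticRank_eq hn.ne_zero hWn]; exact hr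
    exact (CongruentNumber.bsdp_iff hn hWn 2).2 (h₁ n hn hr')
  · haveI := isElliptic_congruentNumberCurve hn.ne_zero
    haveI := isGloballyMinimal_congruentNumberCurve hn
    have hr' : (congruentNumberCurve n).analyticRank = 1 := by
      rw [← analyticRank_eq_of_isIsogenous' hiso]; exact hr
    exact Additive.TwistComparison.bsdp_of_bsdp_of_isIsogenous (congruentNumberCurve n) W 2 hCassels
      hGZK hmod hiso.symm_of_charZero hr'.le (h₁ n hn hr')
  · exact h A hA hneg hpos W hW hr

/-- **THE RAMIFIED CLASS MODULO THE TRANSPORT FACTS OF `𝔅_ram`.** Granted Cassels, GZK and analytic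
continuation (displayed), `WAllCornerFTwoRamified` (consequent of crux 20362) is EQUIVALENT to:
(1) `BSD(E_n,2)` on the named model for every square-free `n` with `r_an(E_n) = 1`; (2″) `BSD(W,2)`
for every globally minimal model `W` of analytic rank one of `y² = x³ + Ax`, `A ∈ ℤ∖{0}` with
`A ∉ ℤ²` AND `−A ∉ ℤ²`; (3) the square-free twists of `⟨0,−6,0,1,0⟩` (`j = 287496`; by p4's
`ramified_j287496_iff_congruent` this conjunct too folds onto (1) — combine by name, not restated);
(4) the square-free twists of `cm8` (`j = 8000`, `K = ℚ(√−2)`: isogenous to nothing in (1), the CM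
field being an isogeny invariant). [cite: Miller2011LMS, §1 and Def. 1.1] [cite: SilvermanAEC2009, III.4 Example 4.5 and X.5 Prop. 5.4] -/
theorem wAllCornerFTwoRamified_iff_models_of_transport (hCassels : bsdRHS_eq_of_isIsogenous)
    (hGZK : rank_eq_analyticRank_of_analyticRank_le_one) (hmod : hasEntireLFunction_rat) :
    WAllCornerFTwoRamified ↔
      (∀ n : ℕ, Squarefree n → (congruentNumberCurve n).analyticRank = 1 →
          BSDp (congruentNumberCurve n) 2) ∧
      (∀ A : ℤ, A ≠ 0 → ¬ IsSquare (-A) → ¬ IsSquare A →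
        ∀ (W : WeierstrassCurve ℚ) [W.IsElliptic] [W.IsGloballyMinimal],
          (∃ C : VariableChange ℚ, C • (⟨0, 0, 0, (A : ℚ), 0⟩ : WeierstrassCurve ℚ) = W) →
          W.analyticRank = 1 → BSDp W 2) ∧
      (∀ d : ℤ, d ≠ 0 → Squarefree d →
        ∀ (W : WeierstrassCurve ℚ) [W.IsElliptic] [W.IsGloballyMinimal],
          (∃ C : VariableChange ℚ,
            C • (⟨0, -6, 0, 1, 0⟩ : WeierstrassCurve ℚ).quadraticTwist (d : ℚ) = W) →
          W.analyticRank = 1 → BSDp W 2) ∧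
      (∀ d : ℤ, d ≠ 0 → Squarefree d →
        ∀ (W : WeierstrassCurve ℚ) [W.IsElliptic] [W.IsGloballyMinimal],
          (∃ C : VariableChange ℚ, C • cm8.quadraticTwist (d : ℚ) = W) →
          W.analyticRank = 1 → BSDp W 2) := by
  rw [wAllCornerFTwoRamified_iff_models]
  constructor
  · rintro ⟨h₁, h₂, h₃, h₄⟩
    exact ⟨h₁, (quarticConjunct_iff_of_transport hCassels hGZK hmod h₁).1 h₂, h₃, h₄⟩
  · rintro ⟨h₁, h₂, h₃, h₄⟩
    exact ⟨h₁, (quarticConjunct_iff_of_transport hCassels hGZK hmod h₁).2 h₂, h₃, h₄⟩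

end Summit.BirchSwinnertonDyer.Rank1Residual.P2.CornerFTwo

end
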